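import Mathlib
import Literature.Analysis.FluidPDE.Tao2016AveragedNS.BoundedEternalSolutions
import HarnessLib

/-!
# `WakeRatchet.TailRatchet` (stmt-NavierStokesRegularity-21808): the AMPLITUDE FLOOR of admissible
# discretely self-similar cascade waves — no small DSS fronts, and none at all on zero-outflow tables

Support file for the crux `TailRatchet` (route `WakeRatchet`; MODEL lattice ODEs of Tao 2016 §4 —
nothing in this file is a statement about the Navier–Stokes equations, and no item is closed here).

WHY.  The crux is refuted exactly modulo the existence, at arbitrarily small scale ratios `1+ε₀`, of
non-trivial admissible DSS waves on a table of a fixed class `E₂(R)` (tree: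
`tailRatchet_false_of_persistentDSSWaves`, `TailRatchet_false_of_DyadicScalarFronts`).  This file
proves a structural constraint every such construction must meet, for EVERY cancelling table, every
period and every profile family: integrating the summed energy identity
`E' = −2d·E + 2c₁·F(·+T) − 2c₂·F` (tree `hasDerivAt_sEnergy`; `E = Σ_r ‖Φ_r‖²`, `F` the summed
flux) over the whole line — the shift `·+T` is invisible to the integral — gives the GLOBAL BALANCE
  `d · ∫ E = (c₁ − c₂) · ∫ F`                                   (`integral_sEnergy_eq`),
and with the flux bound `|F| ≤ C_A · E · (sup Σ_r‖Φ_r‖)` (tree `abs_sFlux_le`):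
* `sWave_eq_zero_of_small_mass` — if `|c₁ − c₂| · C_A · sup_x Σ_r‖Φ_r(x)‖ < d` the wave is trivial;
* for admissible DSS waves of a cancelling table (`d = 1`, `c₁ = Λ`, `c₂ = Λ⁻¹`, `C_A = fluxConst α`):
  `dssWave_eq_zero_of_small_mass`, and the AMPLITUDE FLOOR `dssWave_one_le_of_ne_zero`:
  a non-trivial wave has `|Λ − Λ⁻¹| · fluxConst α · sup_x Σ_r‖Φ_r(x)‖ ≥ 1`;
* `dssWave_eq_zero_of_fluxConst_eq_zero` — a cancelling table with ZERO OUTFLOW (`fluxConst α = 0`,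
  e.g. the zero table, which lies in every `E₂(R)`) carries no non-trivial admissible DSS wave at any
  scale ratio;
* `bigLam_sub_inv_lt` — `Λ − Λ⁻¹ < 14 ε₀` for `0 < ε₀ ≤ 1`; hence on `R`-comparable cancelling tables
  (`fluxConst ≤ 4³ = 64`) every non-trivial admissible DSS wave has a phase `x` with
  `Σ_r ‖Φ_r(x)‖ > 1/(896 ε₀)` (`dssWave_exists_large_mass`), and any uniform bound `C` on the profiles
  satisfies `|ρ| · C > 1/(896 ε₀)` (`dssWave_card_mul_bound_large`).

READING FOR THE CENSUS of stmt-21808.  The renormalised amplitude (equivalently the type-I constant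
`sup Λⁿ(t⋆−t)‖X_n(t)‖`) of ANY fixed-spread DSS front diverges at least like `1/(896 ε₀)` as
`ε₀ → 0`: the fronts the refutation needs are LARGE objects (consistent with the continuum scaling
`W ≈ V / log Λ` of the dyadic front), so no construction perturbing around `W = 0`, and no invariant
box of `ε₀`-independent size (in the chain `not_tailRatchet_of_invariantSets_weak`), can succeed.

HONEST FRAMING: elementary real analysis on the cell's lemma layer; MODEL lattice only; the crux is
neither proved nor refuted here.
-/

noncomputable section

set_option linter.dupNamespace false

namespace Summit.NavierStokesRegularity.NavierStokesRegularity.Theorems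

namespace WakeRatchetDSSAmplitudeFloor

open MeasureTheory Set Filter Topology
open scoped RealInnerProductSpace
open Literature.Analysis.FluidPDE Literature.Analysis.FluidPDE.TaoCascade

section Abstract

variable {V : Type*} [NormedAddCommGroup V] [InnerProductSpace ℝ V]
variable {ρ : Type*} [Fintype ρ]

omit [InnerProductSpace ℝ V] in
/-- `E ≤ (sup Σ‖Φ_r‖) · Σ‖Φ_r‖`: the summed energy is dominated by the summed mass times its bound.
[folklore] -/
theorem sEnergy_le_mul_sMass (Φ : ρ → ℝ → V) {M₁ : ℝ} (hM : ∀ x, sMass Φ x ≤ M₁) (x : ℝ) :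
    sEnergy Φ x ≤ M₁ * sMass Φ x := by
  unfold sEnergy
  calc (∑ r, ‖Φ r x‖ ^ 2) ≤ ∑ r, M₁ * ‖Φ r x‖ := by
        refine Finset.sum_le_sum fun r _ => ?_
        rw [sq]
        exact mul_le_mul_of_nonneg_right ((norm_le_sMass Φ x r).trans (hM x)) (norm_nonneg _)
    _ = M₁ * sMass Φ x := by rw [← Finset.mul_sum]; rfl

/-- The summed energy of a profile family with integrable, bounded summed mass is integrable.
[folklore] -/
theorem integrable_sEnergy {π : Equiv.Perm ρ} {Q A : V → V} {B : V → V → V} {d c₁ c₂ T : ℝ}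
    {Φ : ρ → ℝ → V} (hΦ : IsSWave π Q A B d c₁ c₂ T Φ) (hmass : Integrable (sMass Φ))
    {M₁ : ℝ} (hM : ∀ x, sMass Φ x ≤ M₁) : Integrable (sEnergy Φ) := by
  refine Integrable.mono' (hmass.const_mul M₁) hΦ.continuous_sEnergy.aestronglyMeasurable
    (Eventually.of_forall fun x => ?_)
  rw [Real.norm_eq_abs, abs_of_nonneg (sEnergy_nonneg Φ x)]
  exact sEnergy_le_mul_sMass Φ hM x

/-- The summed flux is integrable, with `∫ |F| ≤ C_A · M₁ · ∫ E`. [cite: Tao2016AveragedNS, §4 Lemma 4.1 (4.9) (energy flux); cell lemma] -/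
theorem integrable_sFlux {π : Equiv.Perm ρ} {Q A : V → V} {B : V → V → V} {CA d c₁ c₂ T : ℝ}
    (hS : STable Q A B CA) {Φ : ρ → ℝ → V} (hΦ : IsSWave π Q A B d c₁ c₂ T Φ)
    (hmass : Integrable (sMass Φ)) {M₁ : ℝ} (hM : ∀ x, sMass Φ x ≤ M₁) :
    Integrable (sFlux π A T Φ) := by
  have hE := integrable_sEnergy hΦ hmass hM
  refine Integrable.mono' (hE.const_mul (CA * M₁)) (hΦ.continuous_sFlux hS).aestronglyMeasurable
    (Eventually.of_forall fun x => ?_)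
  rw [Real.norm_eq_abs]
  calc |sFlux π A T Φ x| ≤ CA * sEnergy Φ x * sMass Φ (x - T) := abs_sFlux_le hS π T Φ x
    _ ≤ CA * sEnergy Φ x * M₁ :=
        mul_le_mul_of_nonneg_left (hM _) (mul_nonneg hS.CA_nonneg (sEnergy_nonneg Φ x))
    _ = CA * M₁ * sEnergy Φ x := by ring

/-- Pointwise flux bound against the mass bound: `|F(x)| ≤ C_A · M₁ · E(x)`.
[cite: Tao2016AveragedNS, §4 Lemma 4.1 (4.9); cell lemma] -/
theorem abs_sFlux_le_mul {π : Equiv.Perm ρ} {Q A : V → V} {B : V → V → V} {CA : ℝ}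
    (hS : STable Q A B CA) (T : ℝ) (Φ : ρ → ℝ → V) {M₁ : ℝ} (hM : ∀ x, sMass Φ x ≤ M₁) (x : ℝ) :
    |sFlux π A T Φ x| ≤ CA * M₁ * sEnergy Φ x := by
  calc |sFlux π A T Φ x| ≤ CA * sEnergy Φ x * sMass Φ (x - T) := abs_sFlux_le hS π T Φ x
    _ ≤ CA * sEnergy Φ x * M₁ :=
        mul_le_mul_of_nonneg_left (hM _) (mul_nonneg hS.CA_nonneg (sEnergy_nonneg Φ x))
    _ = CA * M₁ * sEnergy Φ x := by ring

/-- **Global energy balance of a profile family.**  For a solution of the profile system with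
integrable bounded summed mass, `d · ∫ E = (c₁ − c₂) · ∫ F`: the integral of
`E' = −2dE + 2c₁F(·+T) − 2c₂F` over the line vanishes, and the shift by `T` does not change `∫ F`.
[cite: Tao2016AveragedNS, §4 (4.3), Lemma 4.1 (4.9)–(4.10) (energy identity); cell theorem] -/
theorem integral_sEnergy_eq {π : Equiv.Perm ρ} {Q A : V → V} {B : V → V → V} {CA d c₁ c₂ T : ℝ}
    (hS : STable Q A B CA) {Φ : ρ → ℝ → V} (hΦ : IsSWave π Q A B d c₁ c₂ T Φ)
    (hmass : Integrable (sMass Φ)) {M₁ : ℝ} (hM : ∀ x, sMass Φ x ≤ M₁) :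
    d * ∫ x, sEnergy Φ x = (c₁ - c₂) * ∫ x, sFlux π A T Φ x := by
  have hE := integrable_sEnergy hΦ hmass hM
  have hF := integrable_sFlux hS hΦ hmass hM
  have hFT : Integrable (fun x => sFlux π A T Φ (x + T)) := hF.comp_add_right T
  have hderiv := fun x => hasDerivAt_sEnergy hS hΦ x
  have hE' : Integrable (fun x => -2 * d * sEnergy Φ x + 2 * c₁ * sFlux π A T Φ (x + T)
      - 2 * c₂ * sFlux π A T Φ x) :=
    ((hE.const_mul _).add (hFT.const_mul _)).sub (hF.const_mul _)
  have h0 := integral_eq_zero_of_hasDerivAt_of_integrable hderiv hE' hE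
  have i1 : Integrable (fun x => -2 * d * sEnergy Φ x) := hE.const_mul _
  have i2 : Integrable (fun x => 2 * c₁ * sFlux π A T Φ (x + T)) := hFT.const_mul _
  have i3 : Integrable (fun x => 2 * c₂ * sFlux π A T Φ x) := hF.const_mul _
  have h1 : ∫ x, (-2 * d * sEnergy Φ x + 2 * c₁ * sFlux π A T Φ (x + T)
      - 2 * c₂ * sFlux π A T Φ x) = (∫ x, (-2 * d * sEnergy Φ x + 2 * c₁ * sFlux π A T Φ (x + T)))
      - ∫ x, 2 * c₂ * sFlux π A T Φ x := integral_sub (i1.add i2) i3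
  have h2 : ∫ x, (-2 * d * sEnergy Φ x + 2 * c₁ * sFlux π A T Φ (x + T))
      = (∫ x, -2 * d * sEnergy Φ x) + ∫ x, 2 * c₁ * sFlux π A T Φ (x + T) := integral_add i1 i2
  have h3 : ∫ x, -2 * d * sEnergy Φ x = -2 * d * ∫ x, sEnergy Φ x := integral_const_mul _ _
  have h4 : ∫ x, 2 * c₁ * sFlux π A T Φ (x + T) = 2 * c₁ * ∫ x, sFlux π A T Φ (x + T) :=
    integral_const_mul _ _
  have h5 : ∫ x, 2 * c₂ * sFlux π A T Φ x = 2 * c₂ * ∫ x, sFlux π A T Φ x := integral_const_mul _ _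
  have hshift : ∫ x, sFlux π A T Φ (x + T) = ∫ x, sFlux π A T Φ x :=
    integral_add_right_eq_self (sFlux π A T Φ) T
  rw [h1, h2, h3, h4, h5, hshift] at h0
  linarith

/-- **No small waves.**  If `|c₁ − c₂| · C_A · sup Σ‖Φ_r‖ < d`, a profile family with integrable
bounded summed mass is trivial: `d ∫E = (c₁−c₂)∫F ≤ |c₁−c₂| C_A M₁ ∫E` forces `∫ E = 0`.
[cite: Tao2016AveragedNS, §4 (4.3), Lemma 4.1 (4.9)–(4.10); cell theorem] -/
theorem sWave_eq_zero_of_small_mass {π : Equiv.Perm ρ} {Q A : V → V} {B : V → V → V} {CA d c₁ c₂ T : ℝ}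
    (hS : STable Q A B CA) {Φ : ρ → ℝ → V} (hΦ : IsSWave π Q A B d c₁ c₂ T Φ)
    (hmass : Integrable (sMass Φ)) {M₁ : ℝ} (hM : ∀ x, sMass Φ x ≤ M₁)
    (hsmall : |c₁ - c₂| * CA * M₁ < d) : ∀ (r : ρ) (x : ℝ), Φ r x = 0 := by
  have hE := integrable_sEnergy hΦ hmass hM
  have hF := integrable_sFlux hS hΦ hmass hM
  have hbal := integral_sEnergy_eq hS hΦ hmass hM
  have hM0 : 0 ≤ M₁ := (sMass_nonneg Φ 0).trans (hM 0)
  -- `|∫ F| ≤ C_A M₁ ∫ E`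
  have hFle : |∫ x, sFlux π A T Φ x| ≤ CA * M₁ * ∫ x, sEnergy Φ x := by
    calc |∫ x, sFlux π A T Φ x| ≤ ∫ x, |sFlux π A T Φ x| := by
          simpa only [Real.norm_eq_abs] using norm_integral_le_integral_norm (sFlux π A T Φ)
      _ ≤ ∫ x, CA * M₁ * sEnergy Φ x :=
          integral_mono hF.abs (hE.const_mul _) fun x => abs_sFlux_le_mul hS T Φ hM x
      _ = CA * M₁ * ∫ x, sEnergy Φ x := integral_const_mul _ _
  have hI0 : 0 ≤ ∫ x, sEnergy Φ x := integral_nonneg fun x => sEnergy_nonneg Φ x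
  -- hence `d ∫E ≤ |c₁ - c₂| C_A M₁ ∫E`, so `∫ E = 0`
  have hle : d * ∫ x, sEnergy Φ x ≤ |c₁ - c₂| * CA * M₁ * ∫ x, sEnergy Φ x := by
    rw [hbal]
    calc (c₁ - c₂) * ∫ x, sFlux π A T Φ x ≤ |c₁ - c₂| * |∫ x, sFlux π A T Φ x| := by
          rw [← abs_mul]; exact le_abs_self _
      _ ≤ |c₁ - c₂| * (CA * M₁ * ∫ x, sEnergy Φ x) :=
          mul_le_mul_of_nonneg_left hFle (abs_nonneg _)
      _ = |c₁ - c₂| * CA * M₁ * ∫ x, sEnergy Φ x := by ring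
  have hint0 : ∫ x, sEnergy Φ x = 0 := by
    by_contra hne
    have hpos : 0 < ∫ x, sEnergy Φ x := lt_of_le_of_ne hI0 (Ne.symm hne)
    have : d * ∫ x, sEnergy Φ x < d * ∫ x, sEnergy Φ x :=
      lt_of_le_of_lt hle (mul_lt_mul_of_pos_right hsmall hpos)
    exact lt_irrefl _ this
  -- a continuous non-negative integrable function with zero integral vanishes identically
  have hae : sEnergy Φ =ᵐ[volume] 0 :=
    (integral_eq_zero_iff_of_nonneg (fun x => sEnergy_nonneg Φ x) hE).1 hint0
  have hzero : sEnergy Φ = 0 :=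
    (Continuous.ae_eq_iff_eq volume hΦ.continuous_sEnergy continuous_const).1 hae
  intro r x
  exact eq_zero_of_sEnergy_eq_zero (congrFun hzero x) r

/-- **Amplitude floor.**  A non-trivial profile family with integrable summed mass bounded by `M₁`
has `d ≤ |c₁ − c₂| · C_A · M₁`. [cite: Tao2016AveragedNS, §4 (4.3), Lemma 4.1 (4.9)–(4.10); cell theorem] -/
theorem sWave_le_of_ne_zero {π : Equiv.Perm ρ} {Q A : V → V} {B : V → V → V} {CA d c₁ c₂ T : ℝ}
    (hS : STable Q A B CA) {Φ : ρ → ℝ → V} (hΦ : IsSWave π Q A B d c₁ c₂ T Φ)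
    (hmass : Integrable (sMass Φ)) {M₁ : ℝ} (hM : ∀ x, sMass Φ x ≤ M₁)
    (hne : ∃ r x, Φ r x ≠ 0) : d ≤ |c₁ - c₂| * CA * M₁ := by
  by_contra h
  push Not at h
  obtain ⟨r, x, hrx⟩ := hne
  exact hrx (sWave_eq_zero_of_small_mass hS hΦ hmass hM h r x)

end Abstract

/-! ## Admissible DSS waves of a cancelling table -/

section DSS

variable {ρ : Type*} [Fintype ρ] {m : ℕ}

/-- **No small admissible DSS waves.**  On a cancelling table, an admissible DSS wave at scale ratio
`1+ε₀` whose summed mass stays below `M₁` with `|Λ − Λ⁻¹| · fluxConst α · M₁ < 1` (`Λ = bigLam ε₀`)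
is trivial. [cite: Tao2016AveragedNS, §4 (4.1)–(4.3), Lemma 4.1 (4.8)–(4.10); cell theorem] -/
theorem dssWave_eq_zero_of_small_mass {ε₀ : ℝ} {α : Fin m → Fin m → Fin m → ℤ × ℤ × ℤ → ℝ}
    {π : Equiv.Perm ρ} {T : ℝ} {Φ : ρ → ℝ → Em m} (hc : IsCancellingCoeff α)
    (hW : IsDSSWave ε₀ α π T Φ) {M₁ : ℝ} (hM : ∀ x, sMass Φ x ≤ M₁)
    (hsmall : |bigLam ε₀ - (bigLam ε₀)⁻¹| * fluxConst α * M₁ < 1) :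
    ∀ (r : ρ) (x : ℝ), Φ r x = 0 :=
  sWave_eq_zero_of_small_mass (table_sTable α hc) hW.wave hW.mass hM hsmall

/-- **Amplitude floor of admissible DSS waves.**  On a cancelling table, a NON-TRIVIAL admissible DSS
wave at scale ratio `1+ε₀` with summed mass bounded by `M₁` has
`1 ≤ |Λ − Λ⁻¹| · fluxConst α · M₁`: its renormalised amplitude is at least
`1 / (|Λ − Λ⁻¹| · fluxConst α)`, which diverges like `ε₀⁻¹` as the scale ratio becomes fine.
[cite: Tao2016AveragedNS, §4 (4.1)–(4.3), Lemma 4.1 (4.8)–(4.10); cell theorem] -/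
theorem dssWave_one_le_of_ne_zero {ε₀ : ℝ} {α : Fin m → Fin m → Fin m → ℤ × ℤ × ℤ → ℝ}
    {π : Equiv.Perm ρ} {T : ℝ} {Φ : ρ → ℝ → Em m} (hc : IsCancellingCoeff α)
    (hW : IsDSSWave ε₀ α π T Φ) {M₁ : ℝ} (hM : ∀ x, sMass Φ x ≤ M₁) (hne : ∃ r x, Φ r x ≠ 0) :
    1 ≤ |bigLam ε₀ - (bigLam ε₀)⁻¹| * fluxConst α * M₁ :=
  sWave_le_of_ne_zero (table_sTable α hc) hW.wave hW.mass hM hne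

/-- **Zero-outflow tables carry no admissible DSS wave.**  If `fluxConst α = 0` (no `(0,0,1)`
monomial: a shell never feeds the shell above — e.g. the zero table, a member of every `E₂(R)`), then
every admissible DSS wave of the cancelling table `α` is trivial, at every scale ratio.
[cite: Tao2016AveragedNS, §4 (4.1)–(4.3); cell theorem] -/
theorem dssWave_eq_zero_of_fluxConst_eq_zero {ε₀ : ℝ}
    {α : Fin m → Fin m → Fin m → ℤ × ℤ × ℤ → ℝ} {π : Equiv.Perm ρ} {T : ℝ} {Φ : ρ → ℝ → Em m}
    (hc : IsCancellingCoeff α) (hW : IsDSSWave ε₀ α π T Φ) (h0 : fluxConst α = 0) :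
    ∀ (r : ρ) (x : ℝ), Φ r x = 0 := by
  obtain ⟨C, hC⟩ := hW.uniformBound
  have hM : ∀ x, sMass Φ x ≤ (Fintype.card ρ : ℝ) * C := by
    intro x
    calc sMass Φ x = ∑ r, ‖Φ r x‖ := rfl
      _ ≤ ∑ _r : ρ, C := Finset.sum_le_sum fun r _ => hC r x
      _ = (Fintype.card ρ : ℝ) * C := by rw [Finset.sum_const, nsmul_eq_mul, Finset.card_univ]
  exact dssWave_eq_zero_of_small_mass hc hW hM (by rw [h0, mul_zero, zero_mul]; exact one_pos)

/-! ## Comparable tables at fine scale ratio: the floor is `1/(896 ε₀)` -/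

/-- `Λ − Λ⁻¹ < 14 ε₀` for `0 < ε₀ ≤ 1` (`Λ = (1+ε₀)^{5/2} < (1+ε₀)³ ≤ 1 + 7ε₀` and
`1 − Λ⁻¹ ≤ Λ − 1`). [cite: Tao2016AveragedNS, §4 (4.1) (the weight `(1+ε₀)^{5/2}`); elementary] -/
theorem bigLam_sub_inv_lt {ε₀ : ℝ} (hε : 0 < ε₀) (hε1 : ε₀ ≤ 1) :
    |bigLam ε₀ - (bigLam ε₀)⁻¹| < 14 * ε₀ := by
  have hb : 1 < 1 + ε₀ := by linarith
  have hΛ1 : 1 ≤ bigLam ε₀ := one_le_bigLam hε.le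
  have hΛ0 : 0 < bigLam ε₀ := by linarith
  have hlt : bigLam ε₀ < (1 + ε₀) ^ (3 : ℕ) := by
    unfold bigLam
    rw [← Real.rpow_natCast]
    exact Real.rpow_lt_rpow_of_exponent_lt hb (by norm_num)
  have hsq : ε₀ ^ 2 ≤ ε₀ := by nlinarith
  have hcu : ε₀ ^ 3 ≤ ε₀ := by nlinarith
  have hcube : (1 + ε₀) ^ (3 : ℕ) ≤ 1 + 7 * ε₀ := by nlinarith
  have hinv : 1 - (bigLam ε₀)⁻¹ ≤ bigLam ε₀ - 1 := by
    have e : 1 - (bigLam ε₀)⁻¹ = (bigLam ε₀ - 1) / bigLam ε₀ := by field_simp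
    rw [e]
    exact div_le_self (sub_nonneg.2 hΛ1) hΛ1
  have hnn : 0 ≤ bigLam ε₀ - (bigLam ε₀)⁻¹ := by
    have : (bigLam ε₀)⁻¹ ≤ 1 := inv_le_one_of_one_le₀ hΛ1
    linarith
  rw [abs_of_nonneg hnn]
  have : bigLam ε₀ - (bigLam ε₀)⁻¹ = (bigLam ε₀ - 1) + (1 - (bigLam ε₀)⁻¹) := by ring
  rw [this]
  linarith

/-- On an `R`-comparable table the flux constant is at most `4³ = 64` (`m = 4`).
[cite: Tao2016AveragedNS, §4 (4.1), §6.1; cell lemma] -/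
theorem fluxConst_le_64 {R : ℝ} {α : Fin 4 → Fin 4 → Fin 4 → ℤ × ℤ × ℤ → ℝ}
    (hα : IsComparableCoeff R α) : fluxConst α ≤ 64 := by
  have h := fluxConst_le_of_abs_le_one α fun i₁ i₂ i₃ =>
    (hα i₁ i₂ i₃ ((0 : ℤ), (0 : ℤ), (1 : ℤ)) (by rw [mem_shiftSet_iff]; simp)).1
  norm_num at h
  exact h

/-- **The floor on comparable tables.**  On a cancelling `R`-comparable table (`m = 4`) at scale
ratio `1+ε₀`, `0 < ε₀ ≤ 1`, a summed-mass bound `M₁ ≤ 1/(896 ε₀)` forces an admissible DSS wave to be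
trivial. [cite: Tao2016AveragedNS, §4 (4.1)–(4.3), §6.1; cell theorem] -/
theorem dssWave_eq_zero_of_mass_le {ε₀ R : ℝ} {α : Fin 4 → Fin 4 → Fin 4 → ℤ × ℤ × ℤ → ℝ}
    {π : Equiv.Perm ρ} {T : ℝ} {Φ : ρ → ℝ → Em 4} (hε : 0 < ε₀) (hε1 : ε₀ ≤ 1)
    (hc : IsCancellingCoeff α) (hα : IsComparableCoeff R α) (hW : IsDSSWave ε₀ α π T Φ)
    (hM : ∀ x, sMass Φ x ≤ 1 / (896 * ε₀)) : ∀ (r : ρ) (x : ℝ), Φ r x = 0 := by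
  refine dssWave_eq_zero_of_small_mass hc hW hM ?_
  have h1 := bigLam_sub_inv_lt hε hε1
  have h2 := fluxConst_le_64 hα
  have h4 : 0 < 1 / (896 * ε₀) := by positivity
  calc |bigLam ε₀ - (bigLam ε₀)⁻¹| * fluxConst α * (1 / (896 * ε₀))
      ≤ |bigLam ε₀ - (bigLam ε₀)⁻¹| * 64 * (1 / (896 * ε₀)) :=
        mul_le_mul_of_nonneg_right (mul_le_mul_of_nonneg_left h2 (abs_nonneg _)) h4.le
    _ < 14 * ε₀ * 64 * (1 / (896 * ε₀)) :=
        mul_lt_mul_of_pos_right (mul_lt_mul_of_pos_right h1 (by norm_num)) h4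
    _ = 1 := by field_simp; ring

/-- **Every non-trivial fixed-spread DSS front is large at fine scale ratio.**  On a cancelling
`R`-comparable table (`m = 4`) at scale ratio `1+ε₀` with `0 < ε₀ ≤ 1`, a non-trivial admissible DSS
wave has a phase where the summed renormalised amplitude exceeds `1/(896 ε₀)`.
[cite: Tao2016AveragedNS, §4 (4.1)–(4.3), §6.1 and §6.4 (renormalised variables); cell theorem] -/
theorem dssWave_exists_large_mass {ε₀ R : ℝ} {α : Fin 4 → Fin 4 → Fin 4 → ℤ × ℤ × ℤ → ℝ}
    {π : Equiv.Perm ρ} {T : ℝ} {Φ : ρ → ℝ → Em 4} (hε : 0 < ε₀) (hε1 : ε₀ ≤ 1)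
    (hc : IsCancellingCoeff α) (hα : IsComparableCoeff R α) (hW : IsDSSWave ε₀ α π T Φ)
    (hne : ∃ r x, Φ r x ≠ 0) : ∃ x, 1 / (896 * ε₀) < sMass Φ x := by
  by_contra h
  push Not at h
  obtain ⟨r, x, hrx⟩ := hne
  exact hrx (dssWave_eq_zero_of_mass_le hε hε1 hc hα hW h r x)

/-- The same floor for a UNIFORM PROFILE BOUND: if `‖Φ_r(x)‖ ≤ C` for all `r, x` (such a `C` always
exists, tree `IsDSSWave.uniformBound`, and is the uniform bound of the carried eternal solution
`dssEmbed`), then `|ρ| · C > 1/(896 ε₀)` for a non-trivial wave — the type-I constant of fixed-spread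
DSS fronts diverges as `ε₀ → 0`.
[cite: Tao2016AveragedNS, §4 (4.1)–(4.3), §6.4; cell theorem] -/
theorem dssWave_card_mul_bound_large {ε₀ R : ℝ} {α : Fin 4 → Fin 4 → Fin 4 → ℤ × ℤ × ℤ → ℝ}
    {π : Equiv.Perm ρ} {T : ℝ} {Φ : ρ → ℝ → Em 4} (hε : 0 < ε₀) (hε1 : ε₀ ≤ 1)
    (hc : IsCancellingCoeff α) (hα : IsComparableCoeff R α) (hW : IsDSSWave ε₀ α π T Φ)
    (hne : ∃ r x, Φ r x ≠ 0) {C : ℝ} (hC : ∀ r x, ‖Φ r x‖ ≤ C) :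
    1 / (896 * ε₀) < (Fintype.card ρ : ℝ) * C := by
  obtain ⟨x, hx⟩ := dssWave_exists_large_mass hε hε1 hc hα hW hne
  have hM : sMass Φ x ≤ (Fintype.card ρ : ℝ) * C := by
    calc sMass Φ x = ∑ r, ‖Φ r x‖ := rfl
      _ ≤ ∑ _r : ρ, C := Finset.sum_le_sum fun r _ => hC r x
      _ = (Fintype.card ρ : ℝ) * C := by rw [Finset.sum_const, nsmul_eq_mul, Finset.card_univ]
  exact lt_of_lt_of_le hx hM

end DSS

end WakeRatchetDSSAmplitudeFloor

end Summit.NavierStokesRegularity.NavierStokesRegularity.Theorems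

end
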